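import Summits.CriticalPhenomena.PercolationContinuityZ3.Theorems.PercNearOneGluingNoHeavyLowerTailSahiCombTriWCertGen
import Summits.CriticalPhenomena.PercolationContinuityZ3.Theorems.PercNearOneGluingNoHeavyLowerTailSahiCombTriWProdCube

/-!
# The q-zeta certificate closes the TRI lane: `CertGenKernel → TriWIneq`

Support file of the one-cut programme (crux `NoHeavyLowerTail`, stmt-CriticalPhenomena-4575; cell `prim-masterthm`, seat P5 gen 18;
memo `FROM-prim-masterthm-p5-g18-SYMMETRIC-MASTER-FORM.md` §9).  Composition of the three landed reductions
`dipoleIneq_of_certGenKernel` (`…TriWCertGen`), `triWGenIneq_of_dipoleIneq` (`…TriWProdCube`) and `triWIneq_of_triWGenIneq` (`…TriWGenU`):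
the OPEN two-index-coordinate weighted triangle inequality `TriWIneq` (all `#β`) — hence TRI ≥ 0 on the triangle class and (M⁺⁺-3) there — follows
from ONE linear-algebra statement, the kernel triviality `CertGenKernel` of the one-parameter q-zeta certificate (census: exhaustive on `Z₂^m`,
`m ≤ 4`, 1.8·10⁶ sampled configurations at `m = 5, 6`).
HONEST LABEL: a conditional theorem; `CertGenKernel` is a typed conjecture, not a fact. [this work]
-/

namespace Summit.CriticalPhenomena.PercolationContinuityZ3.Theorems

namespace FiveUpSet

/-- `CertGenKernel → DipoleIneq`. [this work] -/
theorem dipoleIneq_holds_of_certGenKernel (hK : CertGenKernel) : DipoleIneq :=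
  fun _ _ _ X Y h t hX hY hh => dipoleIneq_of_certGenKernel hK X Y h t hX hY hh

/-- **`CertGenKernel → TriWGenIneq`** (three-family form, no cylinder). [this work] -/
theorem triWGenIneq_of_certGenKernel (hK : CertGenKernel) : TriWGenIneq :=
  triWGenIneq_of_dipoleIneq (dipoleIneq_holds_of_certGenKernel hK)

/-- **`CertGenKernel → TriWIneq`**: the q-zeta certificate's kernel triviality implies the weighted two-coordinate triangle inequality for every
number of index coordinates. [this work] -/
theorem triWIneq_of_certGenKernel (hK : CertGenKernel) : TriWIneq :=
  triWIneq_of_dipoleIneq (dipoleIneq_holds_of_certGenKernel hK)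

end FiveUpSet

end Summit.CriticalPhenomena.PercolationContinuityZ3.Theorems
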